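/-
Copyright (c) 2026. Released under Apache 2.0 license.
-/
import Summits.RiemannHypothesis.RiemannHypothesis.Theorems.MotivicDoorSemilocalMarkov
import HarnessLib

/-!
# Motivic door, semi-local ladder — the odd quintic witness at `b = 0.589`

Pub speedrun, cell `pub-rhdoor`, ladder seat `lad-2`, generation 4: the WITNESS file of
rung R3⁻(0.59) (file 3 of the chain; the Markov form and the mollifier live in
`MotivicDoorSemilocalMarkov.lean` / `MotivicDoorSemilocalMollify.lean`).

The witness is the odd, bounded, piecewise-polynomial function
`G(x) = p(x / b) · 1_{[-b, b]}(x)`, `b = 589/1000`, `p(ξ) = -58 ξ + 255 ξ³ - 189 ξ⁵`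
(found by a small eigenvector search, DATA file `code/gen59.py` of the seat).  This file proves,
exactly and sorry-free:

* `isMarkovWitness_GQ : IsMarkovWitness GQ bQ 502`;
* `integral_norm_sq_GQ : ∫ ‖G‖² = N`, `N = b · 75760/231`;
* the INCREMENT IDENTITY `weilIncrement_GQ_eq`: for `0 ≤ t ≤ 2b`,
  `D_t(G) = 2 b · Δ(t / b)` with `Δ` the explicit degree-11 polynomial `polyR dL`
  (all coefficients rational), and `D_t(G) = 2N` for `t > 2b`;
* `polyR_dL_nonneg : 0 ≤ Δ` on `[0, 2]`.

PROVED here: everything stated.  Nothing in this file is specific to RH beyond the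
normalisations of `Literature.NumberTheory.LFunctions.WeilMarkovQuadratic`.
-/

set_option linter.dupNamespace false

noncomputable section

open MeasureTheory Set Filter Topology Real Finset
open Literature.NumberTheory.LFunctions

namespace Summit.RiemannHypothesis.RiemannHypothesis.Theorems.MotivicDoor.SemilocalQuintic

open SemilocalMarkov

/-! ## Rational-coefficient polynomials in Horner form -/

/-- Horner evaluation of a rational coefficient list: `polyR [c₀, c₁, …] x = c₀ + x (c₁ + x (…))`. -/
def polyR : List ℚ → ℝ → ℝ
  | [], _ => 0
  | c :: l, x => (c : ℝ) + x * polyR l x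

/-- `polyR` is the polynomial `∑ cᵢ xⁱ`. -/
theorem polyR_eq_sum (l : List ℚ) (x : ℝ) :
    polyR l x = ∑ i ∈ range l.length, ((l.getD i 0 : ℚ) : ℝ) * x ^ i := by
  induction l with
  | nil => simp [polyR]
  | cons c l ih =>
    rw [polyR, ih, List.length_cons, Finset.sum_range_succ', Finset.mul_sum]
    simp only [List.getD_cons_succ, List.getD_cons_zero, pow_zero, mul_one, pow_succ]
    rw [add_comm]
    exact congrArg₂ (· + ·) (Finset.sum_congr rfl fun i _ ↦ by ring) rfl

/-- `polyR l` is continuous. -/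
theorem continuous_polyR : ∀ l : List ℚ, Continuous (polyR l)
  | [] => by simpa [polyR] using continuous_const
  | c :: l => by
      have ih := continuous_polyR l
      have : polyR (c :: l) = fun x ↦ (c : ℝ) + x * polyR l x := funext fun x ↦ rfl
      rw [this]; fun_prop

/-- `∫ᵤᵛ ∑ cᵢ xⁱ dx = ∑ cᵢ (v^{i+1} - u^{i+1}) / (i+1)`. -/
theorem integral_sum_pow (c : ℕ → ℝ) (n : ℕ) (u v : ℝ) :
    ∫ x in u..v, ∑ i ∈ range n, c i * x ^ i
      = ∑ i ∈ range n, c i * ((v ^ (i + 1) - u ^ (i + 1)) / (i + 1)) := by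
  rw [intervalIntegral.integral_finsetSum (f := fun i x ↦ c i * x ^ i)
    (fun i _ ↦ (by fun_prop : Continuous fun x : ℝ ↦ c i * x ^ i).intervalIntegrable _ _)]
  refine Finset.sum_congr rfl fun i _ ↦ ?_
  rw [intervalIntegral.integral_const_mul, integral_pow]

/-- `∫ᵤᵛ polyR l`. -/
theorem integral_polyR (l : List ℚ) (u v : ℝ) :
    ∫ x in u..v, polyR l x
      = ∑ i ∈ range l.length, ((l.getD i 0 : ℚ) : ℝ) * ((v ^ (i + 1) - u ^ (i + 1)) / (i + 1)) := by
  simp_rw [polyR_eq_sum]; exact integral_sum_pow _ _ _ _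

/-! ## The witness -/

/-- Half-width of the witness support, `b = 0.589`. -/
def bQ : ℝ := 589 / 1000

/-- The odd quintic profile `p(ξ) = -58 ξ + 255 ξ³ - 189 ξ⁵` on `[-1, 1]`. -/
def pQ (ξ : ℝ) : ℝ := -58 * ξ + 255 * ξ ^ 3 - 189 * ξ ^ 5

/-- The real witness `g(x) = p(x/b) 1_{[-b,b]}(x)`. -/
def gR (x : ℝ) : ℝ := (Icc (-bQ) bQ).indicator (fun x ↦ pQ (x / bQ)) x

/-- The witness as a complex-valued function. -/
def GQ (x : ℝ) : ℂ := (gR x : ℂ)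

/-- `Δ / τ`: coefficients of the increment polynomial divided by `τ`. -/
def qL : List ℚ := [64, 7332, -46322/3, 8820, 501/2, 0, -27621/28, 0, 765/4, 0, -567/44]

/-- Coefficients of the increment polynomial `Δ(τ)`, `D_t(G) = 2 b Δ(t/b)`. -/
def dL : List ℚ := 0 :: qL

/-- `∫_{-1}^{1} p² = 75760/231`. -/
def n2Q : ℚ := 75760 / 231

/-- `N = ‖G‖² = b · 75760/231 = 1115566/5775 ≈ 193.17`. -/
def NQ : ℝ := bQ * n2Q

/-- `0 < b`. -/
theorem bQ_pos : 0 < bQ := by unfold bQ; norm_num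

/-- `b < 0.59`. -/
theorem bQ_lt : bQ < 59 / 100 := by unfold bQ; norm_num

/-- `b < log 2`: the witness support fits the `{∞, 2}` window. -/
theorem bQ_lt_log_two : bQ < Real.log 2 := by
  have := Real.log_two_gt_d9; unfold bQ; linarith

/-- `p` is continuous. -/
theorem continuous_pQ : Continuous pQ := by unfold pQ; fun_prop

/-- `x ↦ p(x/b)` is continuous. -/
theorem continuous_pQ_div : Continuous fun x : ℝ ↦ pQ (x / bQ) :=
  continuous_pQ.comp (continuous_id.div_const bQ)

/-- `p` is odd. -/
theorem pQ_neg (ξ : ℝ) : pQ (-ξ) = -pQ ξ := by unfold pQ; ring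

/-- `|p| ≤ 502` on `[-1, 1]`. -/
theorem abs_pQ_le {ξ : ℝ} (h : |ξ| ≤ 1) : |pQ ξ| ≤ 502 := by
  have h1 := abs_le.1 h
  have h3 : |ξ ^ 3| ≤ 1 := by rw [abs_pow]; exact pow_le_one₀ (abs_nonneg _) h
  have h5 : |ξ ^ 5| ≤ 1 := by rw [abs_pow]; exact pow_le_one₀ (abs_nonneg _) h
  rw [abs_le] at h3 h5 ⊢
  unfold pQ
  constructor <;> linarith [h1.1, h1.2, h3.1, h3.2, h5.1, h5.2]

/-- `g` vanishes off `[-b, b]`. -/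
theorem gR_of_not_mem {x : ℝ} (hx : x ∉ Icc (-bQ) bQ) : gR x = 0 := by
  simp [gR, indicator_of_notMem hx]

/-- `g = p(·/b)` on `[-b, b]`. -/
theorem gR_of_mem {x : ℝ} (hx : x ∈ Icc (-bQ) bQ) : gR x = pQ (x / bQ) := by
  simp [gR, indicator_of_mem hx]

/-- `|g| ≤ 502`. -/
theorem abs_gR_le (x : ℝ) : |gR x| ≤ 502 := by
  by_cases hx : x ∈ Icc (-bQ) bQ
  · rw [gR_of_mem hx]
    refine abs_pQ_le ?_
    rw [abs_div, abs_of_pos bQ_pos, div_le_one bQ_pos, abs_le]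
    exact hx
  · rw [gR_of_not_mem hx, abs_zero]; norm_num

/-- `g` is odd. -/
theorem gR_neg (x : ℝ) : gR (-x) = -gR x := by
  by_cases hx : x ∈ Icc (-bQ) bQ
  · have hx' : -x ∈ Icc (-bQ) bQ := by
      rw [Set.mem_Icc] at hx ⊢; constructor <;> linarith [hx.1, hx.2]
    rw [gR_of_mem hx, gR_of_mem hx', neg_div, pQ_neg]
  · have hx' : -x ∉ Icc (-bQ) bQ := fun h ↦ hx (by
      rw [Set.mem_Icc] at h ⊢; constructor <;> linarith [h.1, h.2])
    rw [gR_of_not_mem hx, gR_of_not_mem hx', neg_zero]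

/-- `g` is measurable. -/
theorem measurable_gR : Measurable gR :=
  continuous_pQ_div.measurable.indicator measurableSet_Icc

/-- `‖G x‖ = |g x|`. -/
theorem norm_GQ (x : ℝ) : ‖GQ x‖ = |gR x| := by
  rw [GQ, Complex.norm_real, Real.norm_eq_abs]

/-- The quintic witness is a Markov witness with `b = 0.589`, `M = 502`. -/
theorem isMarkovWitness_GQ : IsMarkovWitness GQ bQ 502 := by
  refine IsMarkovWitness.intro (Complex.measurable_ofReal.comp measurable_gR)
    (fun x ↦ by rw [norm_GQ]; exact abs_gR_le x) (fun x hx ↦ ?_) (fun x ↦ ?_) ?_ bQ_pos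
  · have : x ∉ Icc (-bQ) bQ := fun h ↦ by
      rw [Set.mem_Icc] at h; exact (abs_le.2 h).not_gt hx
    simp [GQ, gR_of_not_mem this]
  · simp [GQ, gR_neg]
  · have h0 : volume ({-bQ, bQ} : Set ℝ) = 0 :=
      (Set.toFinite ({-bQ, bQ} : Set ℝ)).measure_zero volume
    refine (measure_eq_zero_iff_ae_notMem.1 h0).mono fun x hx ↦ ?_
    simp only [mem_insert_iff, mem_singleton_iff, not_or] at hx
    by_cases h : x ∈ Ioo (-bQ) bQ
    · have hev : (fun y ↦ ((pQ (y / bQ) : ℝ) : ℂ)) =ᶠ[𝓝 x] GQ := by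
        filter_upwards [Ioo_mem_nhds h.1 h.2] with y hy
        simp [GQ, gR_of_mem (Ioo_subset_Icc_self hy)]
      exact ((Complex.continuous_ofReal.comp continuous_pQ_div).continuousAt).congr hev
    · have hout : x ∉ Icc (-bQ) bQ := fun hm ↦
        h ⟨lt_of_le_of_ne hm.1 (Ne.symm hx.1), lt_of_le_of_ne hm.2 hx.2⟩
      have hev : (fun _ ↦ (0 : ℂ)) =ᶠ[𝓝 x] GQ := by
        filter_upwards [isClosed_Icc.isOpen_compl.mem_nhds hout] with y hy
        simp [GQ, gR_of_not_mem hy]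
      exact continuousAt_const.congr hev

/-! ## `‖G‖²` -/

/-- `x ↦ g(x)²` is integrable. -/
theorem integrable_gR_sq : Integrable fun x ↦ gR x ^ 2 := by
  have := isMarkovWitness_GQ.integrable_norm_sq
  refine this.congr (Eventually.of_forall fun x ↦ ?_)
  simp only [norm_GQ, sq_abs]

/-- `∫ g² = N`. -/
theorem integral_gR_sq : ∫ x, gR x ^ 2 = NQ := by
  have hb := bQ_pos
  rw [← setIntegral_eq_integral_of_forall_compl_eq_zero (s := Icc (-bQ) bQ)
    (fun x hx ↦ by rw [gR_of_not_mem hx]; ring)]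
  rw [setIntegral_congr_fun measurableSet_Icc
    (fun x hx ↦ by simp only [gR_of_mem hx] :
      EqOn (fun x ↦ gR x ^ 2) (fun x ↦ pQ (x / bQ) ^ 2) (Icc (-bQ) bQ))]
  rw [integral_Icc_eq_integral_Ioc, ← intervalIntegral.integral_of_le (by linarith),
    intervalIntegral.integral_comp_div (fun ξ ↦ pQ ξ ^ 2) hb.ne',
    show -bQ / bQ = -1 by rw [neg_div, div_self hb.ne'], div_self hb.ne']
  have e : (fun ξ ↦ pQ ξ ^ 2)
      = fun ξ ↦ polyR [0, 0, 3364, 0, -29580, 0, 86949, 0, -96390, 0, 35721] ξ := by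
    funext ξ; simp only [polyR, pQ]; push_cast; ring
  rw [e, integral_polyR]
  simp only [List.length_cons, List.length_nil, Finset.sum_range_succ, Finset.sum_range_zero,
    List.getD]
  norm_num [NQ, n2Q, bQ]

/-- `‖G‖² = N`. -/
theorem integral_norm_sq_GQ : ∫ x, ‖GQ x‖ ^ 2 = NQ := by
  rw [← integral_gR_sq]
  exact integral_congr_ae (Eventually.of_forall fun x ↦ by simp only [norm_GQ, sq_abs])

/-! ## The increment identity -/

/-- Coefficient of `ξʲ` in `p(ξ + τ) p(ξ)`. -/
def cj (τ : ℝ) : ℕ → ℝ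
  | 0 => 0
  | 1 => 3364 * τ - 14790 * τ ^ 3 + 10962 * τ ^ 5
  | 2 => 3364 - 44370 * τ ^ 2 + 54810 * τ ^ 4
  | 3 => -59160 * τ + 174645 * τ ^ 3 - 48195 * τ ^ 5
  | 4 => -29580 + 304695 * τ ^ 2 - 240975 * τ ^ 4
  | 5 => 260847 * τ - 530145 * τ ^ 3 + 35721 * τ ^ 5
  | 6 => 86949 - 626535 * τ ^ 2 + 178605 * τ ^ 4
  | 7 => -385560 * τ + 357210 * τ ^ 3
  | 8 => -96390 + 357210 * τ ^ 2
  | 9 => 178605 * τ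
  | 10 => 35721
  | _ => 0

/-- `p(ξ + τ) p(ξ) = ∑ⱼ cⱼ(τ) ξʲ`. -/
theorem pQ_add_mul_pQ (ξ τ : ℝ) :
    pQ (ξ + τ) * pQ ξ = ∑ j ∈ range 11, cj τ j * ξ ^ j := by
  simp only [Finset.sum_range_succ, Finset.sum_range_zero, cj, pQ]; ring

/-- The exact autocorrelation: `∫_{-1}^{1-τ} p(ξ+τ) p(ξ) dξ = 75760/231 - Δ(τ)`. -/
theorem kappa_identity (τ : ℝ) :
    ∑ j ∈ range 11, cj τ j * (((1 - τ) ^ (j + 1) - (-1) ^ (j + 1)) / (j + 1))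
      = (n2Q : ℝ) - polyR dL τ := by
  simp only [Finset.sum_range_succ, Finset.sum_range_zero, cj, polyR, dL, qL, n2Q]
  push_cast
  ring

/-- For `t ≥ 0`, `g(x+t) g(x) = p((x+t)/b) p(x/b) 1_{[-b, b-t]}(x)`. -/
theorem gR_shift_mul {t : ℝ} (ht : 0 ≤ t) (x : ℝ) :
    gR (x + t) * gR x
      = (Icc (-bQ) (bQ - t)).indicator (fun x ↦ pQ ((x + t) / bQ) * pQ (x / bQ)) x := by
  by_cases hx : x ∈ Icc (-bQ) (bQ - t)
  · have h1 : x ∈ Icc (-bQ) bQ := ⟨hx.1, by linarith [hx.2]⟩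
    have h2 : x + t ∈ Icc (-bQ) bQ := ⟨by linarith [hx.1], by linarith [hx.2]⟩
    rw [gR_of_mem h2, gR_of_mem h1, indicator_of_mem hx]
  · rw [indicator_of_notMem hx]
    rw [Set.mem_Icc, not_and_or, not_le, not_le] at hx
    rcases hx with h | h
    · rw [gR_of_not_mem (x := x) (fun h' ↦ by linarith [h'.1]), mul_zero]
    · rw [gR_of_not_mem (x := x + t) (fun h' ↦ by linarith [h'.2]), zero_mul]

/-- The autocorrelation integral for `0 ≤ t ≤ 2b`. -/
theorem integral_gR_shift_mul {t : ℝ} (ht0 : 0 ≤ t) (ht : t ≤ 2 * bQ) :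
    ∫ x, gR (x + t) * gR x = bQ * ((n2Q : ℝ) - polyR dL (t / bQ)) := by
  have hb := bQ_pos
  simp_rw [gR_shift_mul ht0]
  rw [integral_indicator measurableSet_Icc, integral_Icc_eq_integral_Ioc,
    ← intervalIntegral.integral_of_le (by linarith)]
  have e : ∀ x, pQ ((x + t) / bQ) * pQ (x / bQ)
      = (fun ξ ↦ pQ (ξ + t / bQ) * pQ ξ) (x / bQ) := fun x ↦ by simp only [add_div]
  simp_rw [e]
  rw [intervalIntegral.integral_comp_div (fun ξ ↦ pQ (ξ + t / bQ) * pQ ξ) hb.ne',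
    show -bQ / bQ = -1 by rw [neg_div, div_self hb.ne'],
    show (bQ - t) / bQ = 1 - t / bQ by rw [sub_div, div_self hb.ne']]
  simp_rw [pQ_add_mul_pQ]
  rw [integral_sum_pow, kappa_identity, smul_eq_mul]

/-- The autocorrelation vanishes for `t > 2b` (disjoint supports). -/
theorem integral_gR_shift_mul_of_lt {t : ℝ} (ht : 2 * bQ < t) :
    ∫ x, gR (x + t) * gR x = 0 := by
  refine integral_eq_zero_of_ae (Eventually.of_forall fun x ↦ ?_)
  by_cases hx : x ∈ Icc (-bQ) bQ
  · have : x + t ∉ Icc (-bQ) bQ := fun h ↦ by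
      have := h.2; have := hx.1; linarith
    simp [gR_of_not_mem this]
  · simp [gR_of_not_mem hx]

/-- `x ↦ g(x+t) g(x)` is integrable. -/
theorem integrable_gR_shift_mul (t : ℝ) : Integrable fun x ↦ gR (x + t) * gR x := by
  refine integrable_of_norm_le_of_eq_zero (C := 502 * 502) (R := bQ)
    ((measurable_gR.comp (measurable_id.add_const t)).mul measurable_gR).aestronglyMeasurable
    (fun x ↦ ?_) (fun x hx ↦ ?_)
  · rw [norm_mul, Real.norm_eq_abs, Real.norm_eq_abs]
    exact mul_le_mul (abs_gR_le _) (abs_gR_le _) (abs_nonneg _) (by norm_num)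
  · have : x ∉ Icc (-bQ) bQ := fun h ↦ by
      rw [Set.mem_Icc] at h; exact (abs_le.2 h).not_gt hx
    rw [gR_of_not_mem this, mul_zero]

/-- Polarisation: `D_t(G) = 2N - 2 ∫ g(x+t) g(x) dx`. -/
theorem weilIncrement_GQ (t : ℝ) :
    weilIncrement GQ t = 2 * NQ - 2 * ∫ x, gR (x + t) * gR x := by
  unfold weilIncrement
  have e : ∀ x, ‖GQ (x + t) - GQ x‖ ^ 2
      = gR (x + t) ^ 2 + gR x ^ 2 - 2 * (gR (x + t) * gR x) := fun x ↦ by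
    rw [GQ, GQ, ← Complex.ofReal_sub, Complex.norm_real, Real.norm_eq_abs, sq_abs]; ring
  simp_rw [e]
  have h2 := integrable_gR_sq
  have h1 : Integrable fun x ↦ gR (x + t) ^ 2 := h2.comp_add_right t
  have h3 := integrable_gR_shift_mul t
  have h12 : Integrable fun x ↦ gR (x + t) ^ 2 + gR x ^ 2 := h1.add h2
  have h3' : Integrable fun x ↦ 2 * (gR (x + t) * gR x) := h3.const_mul 2
  rw [integral_sub h12 h3', integral_add h1 h2, integral_const_mul,
    integral_add_right_eq_self (fun x ↦ gR x ^ 2) t, integral_gR_sq]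
  ring

/-- INCREMENT IDENTITY: `D_t(G) = 2 b Δ(t/b)` for `0 ≤ t ≤ 2b`. -/
theorem weilIncrement_GQ_eq {t : ℝ} (ht0 : 0 ≤ t) (ht : t ≤ 2 * bQ) :
    weilIncrement GQ t = 2 * bQ * polyR dL (t / bQ) := by
  rw [weilIncrement_GQ, integral_gR_shift_mul ht0 ht, NQ]; ring

/-- `D_t(G) = 2N` for `t > 2b`. -/
theorem weilIncrement_GQ_eq_of_lt {t : ℝ} (ht : 2 * bQ < t) :
    weilIncrement GQ t = 2 * NQ := by
  rw [weilIncrement_GQ, integral_gR_shift_mul_of_lt ht]; ring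

/-- `Δ(τ) = τ q(τ)`. -/
theorem polyR_dL (τ : ℝ) : polyR dL τ = τ * polyR qL τ := by
  show ((0 : ℚ) : ℝ) + τ * polyR qL τ = _; push_cast; ring

/-- `0 ≤ Δ(τ)` on `[0, 2]` (it is an increment). -/
theorem polyR_dL_nonneg {τ : ℝ} (h0 : 0 ≤ τ) (h2 : τ ≤ 2) : 0 ≤ polyR dL τ := by
  have hb := bQ_pos
  have := weilIncrement_GQ_eq (t := bQ * τ) (by positivity) (by nlinarith)
  rw [mul_div_cancel_left₀ _ hb.ne'] at this
  have h := weilIncrement_nonneg GQ (bQ * τ)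
  rw [this] at h
  nlinarith

end Summit.RiemannHypothesis.RiemannHypothesis.Theorems.MotivicDoor.SemilocalQuintic

end
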